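import Mathlib
import HarnessLib
import Literature.Probability.MarkovChains.MetropolisHastings
import Literature.Probability.MarkovChains.TotalVariation

/-!
# Flow-based MCMC is exact: the independence Metropolis chain (finite state space)

HONEST FRAMING: exact (Metropolis-corrected) sampling algorithms for lattice gauge theory;
figures of merit are autocorrelation/cost numbers at stated couplings and volumes; no
continuum-physics claim.

Venture `LatticeQCDFlow` (cell pub-lqcd), topic `Exactness`, FANOUT row 30 (lean-1); the
statements and proofs are the theory-2 seat's sketch of record (HOME/THEORY-2-Sketch.lean v1.4,
§§ "flow-MCMC chain", "Acceptance rate vs total variation", "Sticking") with the two extras of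
the theory-1 seat's `SketchExactness.lean` (`imhRate_eq`, `imhKernel_smul`).  NEW WORK of the
cell (elementary, folklore-level finite sums), not a published result: nothing here is cited as a
fact; printed counterparts are named in docstrings only.

## Content

A normalizing-flow sampler with an accept/reject step (Albergo–Kanwar–Shanahan 2019,
arXiv:1904.12072 §II.C; Kanwar et al. 2020) proposes `y ∼ q` (the model density, evaluated
exactly through the flow's tractable Jacobian) INDEPENDENTLY of the current state `x` and accepts
with probability `min {1, w(y)/w(x)}`, `w = p/q`.  On a finite state space this is the tree's
Metropolis–Hastings kernel `Literature.Probability.MarkovChains.mhKernel` with the constant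
proposal matrix `T x y := q y`:

* `imhKernel p q := mhKernel (fun _ y => q y) p`; `imhRate_eq` (the AKS acceptance form);
* EXACTNESS for every proposal law `q`, however badly trained: `imhKernel_detailedBalance`
  (E1), `imhKernel_isStationary`, `imhKernel_isRowStochastic`, `imhKernel_smul` (the partition
  function is never needed);
* the price of a bad model is paid in autocorrelation, provably: `imhKernel_diag_ge` (S2, holding
  probability `≥ 1 − q x / p x`, the finite core of Mengersen–Tweedie 1996 Thm 2.1),
  `imh_mixing_lower_bound` (T2-C), `imhKernel_sum_le_of_not_mem` (S3: one-step entry into a set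
  `A` from outside has probability `≤ q(A)`), `imh_sector_mixing_lower_bound` (S3′/T2-D: reaching
  `ε`-accuracy needs `t ≥ (p(A) − μ(A) − ε)/q(A)` steps — topological mode collapse of the model
  becomes topological freezing of the exact chain);
* `accRate_le` (T2-E): mean acceptance at stationarity `≤ 1 − ‖p − q‖_TV`;
* `sector_persistence_lower_bound`, `sector_joint_lower_bound` (T2-R/R′, sticking floor):
  `P(X₀ ∈ A, X_t ∈ A) ≥ p(A)·(1 − q(A)/p(A))₊ᵗ` at stationarity, for every set `A`.

Dictionary to lattice gauge theory: `X` = any finite discretisation of the configuration space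
`G^E`, `p ∝ exp(−S)` (the kernel sees `p` only through ratios), `q` = flow model density.  The
general-state-space version (Tierney 1994/1998, Markov kernels) is a separate file.

Design: target first, model second (`imhKernel p q`), as in the theory-2 sketch, so that the
`Scaling/…` files of row 31 land unchanged on top of this one.
-/

namespace Summit.Ventures.LatticeQCDFlow.Exactness

open Finset
open Literature.Probability.MarkovChains

variable {X : Type*} [Fintype X] [DecidableEq X]

/-! ## The flow-MCMC chain = independence Metropolis–Hastings -/

/-- Flow-based MCMC (Albergo–Kanwar–Shanahan 2019): propose `y ∼ q` independently of the
current state, accept with `min(1, p y q x / (p x q y))`.  This is `mhKernel` with the constant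
proposal matrix `T x y = q y`; `p` = target weight (need not be normalised), `q` = model law. -/
noncomputable def imhKernel (p q : X → ℝ) : X → X → ℝ := mhKernel (fun _ y => q y) p

omit [Fintype X] [DecidableEq X] in
/-- The IMH off-diagonal rate is `q y · min {1, w y / w x}` with `w = p/q`: propose `y ∼ q`,
accept with probability `min {1, w(y)/w(x)}` (Albergo–Kanwar–Shanahan 2019 eq. (11)). -/
theorem imhRate_eq {p q : X → ℝ} (hp : ∀ x, 0 < p x) (hq : ∀ x, 0 < q x) (x y : X) :
    mhRate (fun _ y => q y) p x y = q y * min 1 ((p y / q y) / (p x / q x)) := by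
  unfold mhRate
  rw [(monotone_mul_left_of_nonneg (hq y).le).map_min, mul_one]
  congr 1
  have hqy : q y ≠ 0 := (hq y).ne'
  have hqx : q x ≠ 0 := (hq x).ne'
  have hpx : p x ≠ 0 := (hp x).ne'
  field_simp

/-- **Exactness is free (stationarity).**  `p` is stationary for the flow-MCMC chain for EVERY
proposal law `q` — however badly trained. -/
theorem imhKernel_isStationary {p : X → ℝ} (hp : ∀ x, 0 < p x) (q : X → ℝ) :
    IsStationary p (imhKernel p q) :=
  mhKernel_isStationary hp _

/-- The flow-MCMC kernel is a stochastic matrix when the model law is a probability vector. -/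
theorem imhKernel_isRowStochastic {p q : X → ℝ} (hp : ∀ x, 0 < p x) (hq : ∀ x, 0 ≤ q x)
    (hq1 : ∑ x, q x = 1) : IsRowStochastic (imhKernel p q) :=
  mhKernel_isRowStochastic (fun _ y => hq y) (fun _ => hq1.le) hp

/-- Entries of the flow-MCMC kernel are bounded by the MODEL probability of the destination:
`P x y ≤ q y` for `x ≠ y`. -/
theorem imhKernel_le (p q : X → ℝ) {x y : X} (h : x ≠ y) : imhKernel p q x y ≤ q y :=
  mhKernel_le_of_ne _ _ h

/-- **E1 (exactness, detailed balance).**  The flow-MCMC chain is in detailed balance with `p`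
for EVERY proposal law `q` (one line over the tree's `mhKernel_detailedBalance`): the flow only
affects efficiency, never the invariant law. -/
theorem imhKernel_detailedBalance {p : X → ℝ} (hp : ∀ x, 0 < p x) (q : X → ℝ) :
    DetailedBalance p (imhKernel p q) :=
  mhKernel_detailedBalance hp _

/-- The kernel sees the target only through ratios: the partition function is never needed
(`p ∝ exp(−S)` un-normalised gives the same chain). -/
theorem imhKernel_smul {c : ℝ} (hc : c ≠ 0) (p q : X → ℝ) :
    imhKernel (fun z => c * p z) q = imhKernel p q :=
  mhKernel_smul hc _ p

/-- Off-diagonal entries are also bounded by `p y · q x / p x` (the acceptance factor is at most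
the likelihood ratio). -/
theorem imhKernel_le' {p : X → ℝ} (q : X → ℝ) {x y : X} (h : x ≠ y) :
    imhKernel p q x y ≤ p y * q x / p x := by
  unfold imhKernel
  rw [mhKernel_of_ne (Ne.symm h)]
  exact min_le_right _ _

/-- **S2 (rejection lower bound; finite core of Mengersen–Tweedie 1996, Thm 2.1).**  The holding
probability of the flow-MCMC chain at `x` is at least `1 − q x / p x` (`p` normalised); at the
mode `x⋆` of `p/q` this reads `≥ 1 − 1/w⋆`, so the chain cannot contract total variation faster
than `(1 − 1/w⋆)` per step. -/
theorem imhKernel_diag_ge {p q : X → ℝ} (hp : ∀ x, 0 < p x) (hp1 : ∑ x, p x = 1)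
    (hq : ∀ x, 0 ≤ q x) (x : X) : 1 - q x / p x ≤ imhKernel p q x x := by
  have h1 : ∑ z ∈ univ.erase x, imhKernel p q x z ≤ ∑ z ∈ univ.erase x, p z * q x / p x :=
    sum_le_sum fun z hz => imhKernel_le' q (ne_of_mem_erase hz).symm
  have h2 : ∑ z ∈ univ.erase x, p z * q x / p x ≤ ∑ z, p z * q x / p x :=
    sum_le_sum_of_subset_of_nonneg (erase_subset _ _)
      (fun z _ _ => div_nonneg (mul_nonneg (hp z).le (hq x)) (hp x).le)
  have h3 : ∑ z, p z * q x / p x = q x / p x := by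
    rw [← sum_div, ← sum_mul, hp1, one_mul]
  have h4 : ∑ z, imhKernel p q x z = 1 := mhKernel_sum_eq_one _ _ _
  rw [← add_sum_erase _ _ (mem_univ x)] at h4
  linarith

/-- Un-normalised form of S2: the holding probability at `x` is `≥ 1 − Z_p · q(x)/p(x)` with
`Z_p = Σ p`; wherever the model under-covers the target (`w(x) ≫ Z_p`) the expected holding
time is `≥ w(x)/Z_p` steps. -/
theorem imhKernel_diag_ge' {p q : X → ℝ} (hp : ∀ x, 0 < p x) (hq : ∀ x, 0 ≤ q x) (x : X) :
    1 - (∑ y, p y) * q x / p x ≤ imhKernel p q x x := by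
  have hZ : 0 < ∑ y, p y := sum_pos (fun y _ => hp y) ⟨x, mem_univ x⟩
  have hp' : ∀ y, 0 < (∑ z, p z)⁻¹ * p y := fun y => mul_pos (inv_pos.mpr hZ) (hp y)
  have hp1' : ∑ y, (∑ z, p z)⁻¹ * p y = 1 := by rw [← mul_sum, inv_mul_cancel₀ hZ.ne']
  have h := imhKernel_diag_ge hp' hp1' hq x
  rw [imhKernel_smul (inv_ne_zero hZ.ne')] at h
  have heq : q x / ((∑ z, p z)⁻¹ * p x) = (∑ y, p y) * q x / p x := by
    field_simp
  linarith [heq]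

/-! ## Mode collapse of the model ⇒ slow mixing of the exact chain -/

/-- **T2-C (pointwise form).**  If the chain started from the law `μ` is `ε`-close to `p` in
total variation at time `t`, then `p y − μ y − ε ≤ t · q y` for every configuration `y`: a state
the model under-weights by `p y / q y = w(y)` costs `≳ w(y)` steps (finite-state shadow of
Mengersen–Tweedie 1996 / Liu 1996: IMH relaxation time `= sup p/q`). -/
theorem imh_mixing_lower_bound {p q μ : X → ℝ} (hp : ∀ x, 0 < p x) (hp1 : ∑ x, p x = 1)
    (hq : ∀ x, 0 ≤ q x) (hq1 : ∑ x, q x = 1) (hμ : ∀ x, 0 ≤ μ x) (hμ1 : ∑ x, μ x = 1)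
    (y : X) {t : ℕ} {ε : ℝ} (h : tvDist (lawAt (imhKernel p q) μ t) p ≤ ε) :
    p y - μ y - ε ≤ t * q y :=
  sub_sub_le_mul_of_tvDist_lawAt_le (imhKernel_isRowStochastic hp hq hq1) hμ hμ1 hp1 (hq y)
    (fun _ hx => imhKernel_le p q hx) h

omit [DecidableEq X] in
/-- One step of a stochastic matrix raises the mass of a SET `A` by at most `c` when every row
outside `A` sends at most `c` into `A`. -/
theorem stepLaw_sum_le {P : X → X → ℝ} (hP : IsRowStochastic P) {μ : X → ℝ}
    (hμ : ∀ x, 0 ≤ μ x) (hμ1 : ∑ x, μ x = 1) (A : Finset X) {c : ℝ} (hc0 : 0 ≤ c)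
    (hc : ∀ x, x ∉ A → ∑ y ∈ A, P x y ≤ c) :
    ∑ y ∈ A, stepLaw P μ y ≤ ∑ y ∈ A, μ y + c := by
  classical
  unfold stepLaw
  rw [sum_comm]
  simp_rw [← mul_sum]
  rw [← sum_add_sum_compl A (fun x => μ x * ∑ y ∈ A, P x y)]
  have hin : ∀ x, ∑ y ∈ A, P x y ≤ 1 := fun x =>
    calc ∑ y ∈ A, P x y ≤ ∑ y, P x y :=
          sum_le_sum_of_subset_of_nonneg (subset_univ A) fun y _ _ => hP.1 x y
      _ = 1 := hP.2 x
  have h1 : ∑ x ∈ A, μ x * ∑ y ∈ A, P x y ≤ ∑ x ∈ A, μ x :=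
    sum_le_sum fun x _ =>
      calc μ x * ∑ y ∈ A, P x y ≤ μ x * 1 := mul_le_mul_of_nonneg_left (hin x) (hμ x)
        _ = μ x := mul_one _
  have h2 : ∑ x ∈ Aᶜ, μ x * ∑ y ∈ A, P x y ≤ c :=
    calc ∑ x ∈ Aᶜ, μ x * ∑ y ∈ A, P x y ≤ ∑ x ∈ Aᶜ, μ x * c :=
          sum_le_sum fun x hx => mul_le_mul_of_nonneg_left (hc x (mem_compl.mp hx)) (hμ x)
      _ = (∑ x ∈ Aᶜ, μ x) * c := by rw [sum_mul]
      _ ≤ (∑ x, μ x) * c :=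
          mul_le_mul_of_nonneg_right
            (sum_le_sum_of_subset_of_nonneg (subset_univ _) fun x _ _ => hμ x) hc0
      _ = c := by rw [hμ1, one_mul]
  linarith

omit [DecidableEq X] in
/-- After `t` steps the mass of `A` is at most `μ(A) + t·c`. -/
theorem lawAt_sum_le {P : X → X → ℝ} (hP : IsRowStochastic P) {μ : X → ℝ}
    (hμ : ∀ x, 0 ≤ μ x) (hμ1 : ∑ x, μ x = 1) (A : Finset X) {c : ℝ} (hc0 : 0 ≤ c)
    (hc : ∀ x, x ∉ A → ∑ y ∈ A, P x y ≤ c) (t : ℕ) :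
    ∑ y ∈ A, lawAt P μ t y ≤ ∑ y ∈ A, μ y + t * c := by
  induction t with
  | zero => simp [lawAt_zero]
  | succ t ih =>
    rw [lawAt_succ]
    have hstep := stepLaw_sum_le hP (lawAt_nonneg hP hμ t) (by rw [sum_lawAt hP, hμ1]) A hc0 hc
      (μ := lawAt P μ t)
    push_cast
    linarith

/-- **S3 (sector-entry bound).**  From any configuration outside a set `A` (a topological
sector the model has dropped, say) the flow-MCMC chain enters `A` in one step with probability at
most the MODEL mass `q(A)` — whatever the target mass `p(A)` is; so the hitting time of `A`
dominates a geometric variable of parameter `q(A)` ("mode collapse moves the tunnelling problem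
into training"). -/
theorem imhKernel_sum_le_of_not_mem (p q : X → ℝ) (A : Finset X) {x : X} (hx : x ∉ A) :
    ∑ y ∈ A, imhKernel p q x y ≤ ∑ y ∈ A, q y :=
  sum_le_sum fun _ hy => imhKernel_le p q (ne_of_mem_of_not_mem hy hx).symm

/-- **S3′ / T2-D (topological mode collapse, provable core).**  For the exact flow-MCMC chain
with target `p`, model `q`, start `μ` and ANY set of configurations `A` (e.g. a topological
sector `{Q = k}`): `‖μPᵗ − p‖_TV ≤ ε` forces `p(A) − μ(A) − ε ≤ t · q(A)`.  So a model that gives a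
sector of target weight `p(A)` only weight `q(A)` needs `t ≥ (p(A) − μ(A) − ε)/q(A)` steps from
any start that under-weights `A` — exactness is retained, the cost moves into the
autocorrelation time, and it is invisible to the reverse-KL training loss. -/
theorem imh_sector_mixing_lower_bound {p q μ : X → ℝ} (hp : ∀ x, 0 < p x) (hp1 : ∑ x, p x = 1)
    (hq : ∀ x, 0 ≤ q x) (hq1 : ∑ x, q x = 1) (hμ : ∀ x, 0 ≤ μ x) (hμ1 : ∑ x, μ x = 1)
    (A : Finset X) {t : ℕ} {ε : ℝ} (h : tvDist (lawAt (imhKernel p q) μ t) p ≤ ε) :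
    (∑ y ∈ A, p y) - (∑ y ∈ A, μ y) - ε ≤ t * ∑ y ∈ A, q y := by
  have hP := imhKernel_isRowStochastic hp hq hq1
  have hmass : ∑ x, p x = ∑ x, lawAt (imhKernel p q) μ t x := by rw [sum_lawAt hP, hμ1, hp1]
  have h1 : ∑ y ∈ A, p y - ∑ y ∈ A, lawAt (imhKernel p q) μ t y ≤
      tvDist p (lawAt (imhKernel p q) μ t) := sub_sum_le_tvDist hmass A
  rw [tvDist_comm] at h1
  have hc : ∀ x, x ∉ A → ∑ y ∈ A, imhKernel p q x y ≤ ∑ y ∈ A, q y :=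
    fun x hx => imhKernel_sum_le_of_not_mem p q A hx
  have h2 := lawAt_sum_le hP hμ hμ1 A (sum_nonneg fun y _ => hq y) hc t
  linarith

/-! ## Acceptance rate vs total variation -/

omit [DecidableEq X] in
/-- Mean Metropolis acceptance of the flow proposal AT STATIONARITY:
`E_{x∼p, y∼q} min(1, w(y)/w(x)) = Σ_x Σ_y min(p x q y, p y q x)` (`p`, `q` normalised). -/
noncomputable def accRate (p q : X → ℝ) : ℝ := ∑ x, ∑ y, min (p x * q y) (p y * q x)

/-- **T2-E.  `accRate p q ≤ 1 − ‖p − q‖_TV`.**  (Positive part of a sum ≤ sum of positive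
parts, row by row.)  The qualitative half of "acceptance drops exponentially in the volume for a
fixed imperfection per site". -/
theorem accRate_le {p q : X → ℝ} (hp1 : ∑ x, p x = 1) (hq1 : ∑ x, q x = 1) :
    accRate p q ≤ 1 - tvDist p q := by
  rw [tvDist_eq_sum_filter (by rw [hp1, hq1])]
  have key : ∀ x, ∑ y, min (p x * q y) (p y * q x) ≤ p x - max (p x - q x) 0 := by
    intro x
    rcases le_total (q x) (p x) with hqp | hpq
    · rw [max_eq_left (sub_nonneg.mpr hqp)]
      calc ∑ y, min (p x * q y) (p y * q x) ≤ ∑ y, p y * q x :=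
            sum_le_sum fun y _ => min_le_right _ _
        _ = q x := by rw [← sum_mul, hp1, one_mul]
        _ = p x - (p x - q x) := by ring
    · rw [max_eq_right (sub_nonpos.mpr hpq)]
      calc ∑ y, min (p x * q y) (p y * q x) ≤ ∑ y, p x * q y :=
            sum_le_sum fun y _ => min_le_left _ _
        _ = p x := by rw [← mul_sum, hq1, mul_one]
        _ = p x - 0 := (sub_zero _).symm
  have hsum : accRate p q ≤ ∑ x, (p x - max (p x - q x) 0) := sum_le_sum fun x _ => key x
  rw [sum_sub_distrib, hp1] at hsum
  have hfilter : ∑ x, max (p x - q x) 0 =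
      ∑ x ∈ univ.filter (fun x => q x ≤ p x), (p x - q x) := by
    rw [sum_filter]
    exact sum_congr rfl fun x _ => by
      by_cases h : q x ≤ p x
      · rw [if_pos h, max_eq_left (sub_nonneg.mpr h)]
      · rw [if_neg h, max_eq_right (sub_nonpos.mpr (not_le.mp h).le)]
  linarith [hfilter]

/-! ## Sticking floor: the exact chain inherits topological freezing from a sector deficit -/

omit [Fintype X] in
/-- The point mass `δ_x` is a non-negative vector. -/
theorem single_one_nonneg (x y : X) : (0 : ℝ) ≤ (Pi.single x 1 : X → ℝ) y := by
  rcases eq_or_ne y x with h | h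
  · rw [h, Pi.single_eq_same]; exact zero_le_one
  · rw [Pi.single_eq_of_ne h]

/-- Staying put is one of the `t`-step paths: `(Pᵗ)(x,x) ≥ P(x,x)ᵗ`. -/
theorem pow_diag_le_lawAt_single {P : X → X → ℝ} (hP : IsRowStochastic P) (x : X) (t : ℕ) :
    P x x ^ t ≤ lawAt P (Pi.single x 1) t x := by
  induction t with
  | zero => simp [lawAt_zero]
  | succ t ih =>
    rw [lawAt_succ, pow_succ]
    show _ ≤ ∑ z, lawAt P (Pi.single x 1) t z * P z x
    calc P x x ^ t * P x x ≤ lawAt P (Pi.single x 1) t x * P x x :=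
          mul_le_mul_of_nonneg_right ih (hP.1 x x)
      _ ≤ ∑ z, lawAt P (Pi.single x 1) t z * P z x :=
          single_le_sum (f := fun z => lawAt P (Pi.single x 1) t z * P z x)
            (fun z _ => mul_nonneg (lawAt_nonneg hP (single_one_nonneg x) t z) (hP.1 z x))
            (mem_univ x)

/-- **T2-R (sector sticking floor).**  For the exact flow-MCMC chain and ANY set `A` of
configurations (a topological sector): `Σ_{x∈A} p(x)·(Pᵗ)(x,x) ≥ p(A)·(1 − q(A)/p(A))₊ᵗ`.
Mechanism: the holding probability at `x` is `≥ 1 − q(x)/p(x)` (S2) and Jensen over `A` with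
weights `p(x)/p(A)`. -/
theorem sector_persistence_lower_bound {p q : X → ℝ} (hp : ∀ x, 0 < p x) (hp1 : ∑ x, p x = 1)
    (hq : ∀ x, 0 ≤ q x) (hq1 : ∑ x, q x = 1) (A : Finset X) (hA : 0 < ∑ x ∈ A, p x) (t : ℕ) :
    (∑ x ∈ A, p x) * (max 0 (1 - (∑ x ∈ A, q x) / (∑ x ∈ A, p x))) ^ t
      ≤ ∑ x ∈ A, p x * lawAt (imhKernel p q) (Pi.single x 1) t x := by
  have hK := imhKernel_isRowStochastic hp hq hq1
  have hdiag : ∀ x, max 0 (1 - q x / p x) ≤ imhKernel p q x x := fun x =>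
    max_le (hK.1 x x) (imhKernel_diag_ge hp hp1 hq x)
  have h1 : ∑ x ∈ A, p x * (max 0 (1 - q x / p x)) ^ t
      ≤ ∑ x ∈ A, p x * lawAt (imhKernel p q) (Pi.single x 1) t x :=
    sum_le_sum fun x _ => mul_le_mul_of_nonneg_left
      ((pow_le_pow_left₀ (le_max_left _ _) (hdiag x) t).trans (pow_diag_le_lawAt_single hK x t))
      (hp x).le
  have hw : ∑ x ∈ A, p x / (∑ z ∈ A, p z) = 1 := by rw [← sum_div, div_self hA.ne']
  have hj := Real.pow_arith_mean_le_arith_mean_pow A (fun x => p x / ∑ z ∈ A, p z)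
    (fun x => max 0 (1 - q x / p x)) (fun x _ => div_nonneg (hp x).le hA.le) hw
    (fun x _ => le_max_left _ _) t
  have hterm : ∀ x ∈ A, p x / (∑ z ∈ A, p z) * (1 - q x / p x) =
      p x / (∑ z ∈ A, p z) - q x / (∑ z ∈ A, p z) := fun x _ => by
    rw [mul_sub, mul_one, div_mul_div_comm, mul_comm (p x) (q x), mul_div_mul_right _ _ (hp x).ne']
  have hid : ∑ x ∈ A, p x / (∑ z ∈ A, p z) * (1 - q x / p x) =
      1 - (∑ x ∈ A, q x) / (∑ z ∈ A, p z) := by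
    rw [sum_congr rfl hterm, sum_sub_distrib, hw, ← sum_div]
  have h3 : max 0 (1 - (∑ x ∈ A, q x) / (∑ z ∈ A, p z)) ≤
      ∑ x ∈ A, p x / (∑ z ∈ A, p z) * max 0 (1 - q x / p x) := by
    apply max_le
    · exact sum_nonneg fun x _ => mul_nonneg (div_nonneg (hp x).le hA.le) (le_max_left _ _)
    · rw [← hid]
      exact sum_le_sum fun x _ =>
        mul_le_mul_of_nonneg_left (le_max_right _ _) (div_nonneg (hp x).le hA.le)
  have h4 : (∑ z ∈ A, p z) * ∑ x ∈ A, p x / (∑ z ∈ A, p z) * (max 0 (1 - q x / p x)) ^ t =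
      ∑ x ∈ A, p x * (max 0 (1 - q x / p x)) ^ t := by
    rw [mul_sum]
    exact sum_congr rfl fun x _ => by
      rw [div_mul_eq_mul_div, mul_div_assoc', mul_div_cancel_left₀ _ hA.ne']
  calc (∑ x ∈ A, p x) * (max 0 (1 - (∑ x ∈ A, q x) / (∑ x ∈ A, p x))) ^ t
        ≤ (∑ z ∈ A, p z) * (∑ x ∈ A, p x / (∑ z ∈ A, p z) * max 0 (1 - q x / p x)) ^ t :=
          mul_le_mul_of_nonneg_left (pow_le_pow_left₀ (le_max_left _ _) h3 t) hA.le
    _ ≤ (∑ z ∈ A, p z) * ∑ x ∈ A, p x / (∑ z ∈ A, p z) * (max 0 (1 - q x / p x)) ^ t :=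
          mul_le_mul_of_nonneg_left hj hA.le
    _ = ∑ x ∈ A, p x * (max 0 (1 - q x / p x)) ^ t := h4
    _ ≤ ∑ x ∈ A, p x * lawAt (imhKernel p q) (Pi.single x 1) t x := h1

/-- **T2-R′ (two-time form).**  At stationarity, `P(X₀ ∈ A, X_t ∈ A) =
Σ_{x∈A} Σ_{y∈A} p(x)(Pᵗ)(x,y) ≥ p(A)·(1 − q(A)/p(A))₊ᵗ`; hence the lag-`t` autocorrelation of
the sector indicator is `ρ_t(1_A) ≥ ((1 − q(A)/p(A))₊ᵗ − p(A))/(1 − p(A))`: an under-covered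
sector (`q(A) ≪ p(A)`) keeps the exact chain topologically frozen for `≍ p(A)/q(A)` steps,
however high the MEAN acceptance is. -/
theorem sector_joint_lower_bound {p q : X → ℝ} (hp : ∀ x, 0 < p x) (hp1 : ∑ x, p x = 1)
    (hq : ∀ x, 0 ≤ q x) (hq1 : ∑ x, q x = 1) (A : Finset X) (hA : 0 < ∑ x ∈ A, p x) (t : ℕ) :
    (∑ x ∈ A, p x) * (max 0 (1 - (∑ x ∈ A, q x) / (∑ x ∈ A, p x))) ^ t
      ≤ ∑ x ∈ A, ∑ y ∈ A, p x * lawAt (imhKernel p q) (Pi.single x 1) t y := by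
  have hK := imhKernel_isRowStochastic hp hq hq1
  refine (sector_persistence_lower_bound hp hp1 hq hq1 A hA t).trans ?_
  exact sum_le_sum fun x hx =>
    single_le_sum (f := fun y => p x * lawAt (imhKernel p q) (Pi.single x 1) t y)
      (fun y _ => mul_nonneg (hp x).le (lawAt_nonneg hK (single_one_nonneg x) t y)) hx

end Summit.Ventures.LatticeQCDFlow.Exactness
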